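import Mathlib.Data.Nat.Factorization.Induction
import Summits.KontsevichZagierPeriods.KontsevichZagierPeriods.Theorems.HurwitzMicroSectorsNormalFormPrincipleDlogMoves
import Summits.KontsevichZagierPeriods.KontsevichZagierPeriods.Theorems.HurwitzMicroSectorsNormalFormPrincipleSplitMoves

/-!
# `NormalFormPrinciple` (stmt-KontsevichZagierPeriods-3869), line `SketchIdeator1` — stub
# `nf_pole_one`: a simple rational pole on the unit slab is in normal form

The registered sub-goal `nf_pole_one` of the split-denominator layer of the leaf
`stub_boxRigidity` (lead notes `Cruxes/NormalFormPrinciple/NOTES-c3.md`), verbatim: for rationals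
`c` and `ρ ∉ [0,1]`, the representation `T = [(0,1), c/(x − ρ)]` equals, in
`FormalRep ⧸ KZ.relations`, a **normal form** `[pt, r] + Σ_{p ∈ S} Λ(p, C_p)` with `r ∈ ℚ`, `S` a
finite set of primes and `Λ(p, C) := [(1,p), C/y]` the prime **carriers** (here `r = 0`).

Proof — assembled from the LANDED move lemmas of this crux only (`…DlogMoves.lean` p107004:
merging, splitting, scaling, zero integrand, empty slab; `…SplitMoves.lean` p107818: affine moves of
either orientation, `[pt, 0]`), with elementary arithmetic as the only other input:

1. one **affine move** (`Dlog.affine_sub_mem_relations`; translation `y = x − ρ` if `ρ < 0`,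
   reflection `y = ρ − x` if `ρ > 1`) puts `T` onto a dlog representation `[(a, b), c'/y]`,
   `0 < a < b` rational, `c' = ±c` (`exists_dlog_of_pole`);
2. clearing denominators by the dilation `y ↦ D y`, `D = den(a)·den(b)` (scaling, rule 2) and
   splitting `[(1,B)]` at `A` (rule 1a) writes it as a difference of two **integer carriers**
   `Λ(B, c') − Λ(A, c')`, `1 ≤ A = D a < B = D b` (`dlog_eq_carrier_sub`);
3. the carriers are **multiplicative** in the integer (`carrier_mul`: splitting at `M ∈ [1, MN]` and
   the dilation `y ↦ M y`), hence `Λ(N, c') = Σ_p v_p(N) • Λ(p, c')` (`carrier_eq_sum_factorization`,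
   unique factorisation via `induction_on_primes`);
4. the carriers are **additive** in the coefficient (`carrier_add`, merging rule 1b), so the integer
   multiplicities are absorbed into rational coefficients `C_p = (v_p(B) − v_p(A))·c'`;
5. `[pt, 0] ∈ relations` (`Dlog.pt_zero_mem_relations`).

Sources: M. Kontsevich, D. Zagier, *Periods* (2001), §1.1 (`log 2 = ∫₁² dx/x`), §1.2 rules (1), (2).
No definitions are introduced; carriers and point representations are quantified through the
families `R`, `Z` with their domain/integrand descriptions, exactly as in the registered signature.
-/

noncomputable section

open MeasureTheory Set
open Literature.NumberTheory.Transcendental Literature.NumberTheory.Transcendental.KZ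

namespace Summit.KontsevichZagierPeriods.HurwitzMicroSectors.NormalFormPrinciple.PiBox.Dlog

namespace LandedAssembly

variable {R : ℚ → ℚ → ℚ → IntegralRep 1}

/-- **Additivity of the carriers in the coefficient** (merging, rule 1b):
`Λ(b, c₁ + c₂) = Λ(b, c₁) + Λ(b, c₂)` in `FormalRep ⧸ relations`, where `Λ(b, c) = R 1 b c =
[(1,b), c/y]`. [cite: KontsevichZagier2001, §1.2 rule (1)] -/
theorem carrier_add
    (hR : ∀ a b c, 0 < a → (R a b c).domain = {x | x 0 ∈ Set.Ioo (a:ℝ) b} ∧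
      (R a b c).integrand = fun x => (c:ℝ) / x 0)
    (b c₁ c₂ : ℚ) :
    QuotientAddGroup.mk' relations (of (R 1 b (c₁ + c₂))) =
      QuotientAddGroup.mk' relations (of (R 1 b c₁)) +
        QuotientAddGroup.mk' relations (of (R 1 b c₂)) := by
  obtain ⟨hd, hi⟩ := hR 1 b (c₁ + c₂) one_pos
  obtain ⟨hd₁, hi₁⟩ := hR 1 b c₁ one_pos
  obtain ⟨hd₂, hi₂⟩ := hR 1 b c₂ one_pos
  have h : of (R 1 b (c₁ + c₂)) - of (R 1 b c₁) - of (R 1 b c₂) ∈ relations :=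
    dlog_merge_mem_relations (R 1 b (c₁ + c₂)) (R 1 b c₁) (R 1 b c₂) hd hd₁ hd₂
      (fun x _ => by rw [hi]) (fun x _ => by rw [hi₁]) (fun x _ => by rw [hi₂])
  rw [← map_add, QuotientAddGroup.mk'_apply, QuotientAddGroup.mk'_apply,
    QuotientAddGroup.eq_iff_sub_mem, ← sub_sub]
  exact h

/-- `Λ(b, 0) = 0` in `FormalRep ⧸ relations` (zero integrand, rule 1).
[cite: KontsevichZagier2001, §1.2 rule (1)] -/
theorem carrier_zero
    (hR : ∀ a b c, 0 < a → (R a b c).domain = {x | x 0 ∈ Set.Ioo (a:ℝ) b} ∧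
      (R a b c).integrand = fun x => (c:ℝ) / x 0)
    (b : ℚ) : QuotientAddGroup.mk' relations (of (R 1 b 0)) = 0 := by
  rw [QuotientAddGroup.mk'_apply, QuotientAddGroup.eq_zero_iff]
  exact dlog_zero_mem_relations (R 1 b 0) fun x _ => by rw [(hR 1 b 0 one_pos).2]

/-- Integer multiples are absorbed into the coefficient: `Λ(b, n·c) = n • Λ(b, c)`.
[cite: KontsevichZagier2001, §1.2 rule (1)] -/
theorem carrier_natCast_mul
    (hR : ∀ a b c, 0 < a → (R a b c).domain = {x | x 0 ∈ Set.Ioo (a:ℝ) b} ∧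
      (R a b c).integrand = fun x => (c:ℝ) / x 0)
    (b c : ℚ) (n : ℕ) :
    QuotientAddGroup.mk' relations (of (R 1 b ((n:ℚ) * c))) =
      n • QuotientAddGroup.mk' relations (of (R 1 b c)) := by
  induction n with
  | zero => rw [Nat.cast_zero, zero_mul, zero_nsmul, carrier_zero hR]
  | succ n ih => rw [Nat.cast_succ, add_mul, one_mul, carrier_add hR, ih, succ_nsmul]

/-- Differences of coefficients: `Λ(b, c₁ − c₂) = Λ(b, c₁) − Λ(b, c₂)`.
[cite: KontsevichZagier2001, §1.2 rule (1)] -/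
theorem carrier_sub
    (hR : ∀ a b c, 0 < a → (R a b c).domain = {x | x 0 ∈ Set.Ioo (a:ℝ) b} ∧
      (R a b c).integrand = fun x => (c:ℝ) / x 0)
    (b c₁ c₂ : ℚ) :
    QuotientAddGroup.mk' relations (of (R 1 b (c₁ - c₂))) =
      QuotientAddGroup.mk' relations (of (R 1 b c₁)) -
        QuotientAddGroup.mk' relations (of (R 1 b c₂)) := by
  have h := carrier_add hR b (c₁ - c₂) c₂
  rw [sub_add_cancel] at h
  rw [h, add_sub_cancel_right]

/-- **Multiplicativity of the carriers** in the integer: for `1 ≤ M`, `1 ≤ N`,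
`Λ(MN, c) = Λ(M, c) + Λ(N, c)` — split `[(1,MN)]` at `M` (rule 1a) and rescale `[(M, MN)]` to
`[(1,N)]` by the dilation `y ↦ M y` (rule 2). [cite: KontsevichZagier2001, §1.2 rules (1), (2)] -/
theorem carrier_mul
    (hR : ∀ a b c, 0 < a → (R a b c).domain = {x | x 0 ∈ Set.Ioo (a:ℝ) b} ∧
      (R a b c).integrand = fun x => (c:ℝ) / x 0)
    (M N : ℕ) (hM : 1 ≤ M) (hN : 1 ≤ N) (c : ℚ) :
    QuotientAddGroup.mk' relations (of (R 1 ((M * N : ℕ) : ℚ) c)) =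
      QuotientAddGroup.mk' relations (of (R 1 M c)) +
        QuotientAddGroup.mk' relations (of (R 1 N c)) := by
  have hM0 : (0:ℚ) < M := by exact_mod_cast hM
  obtain ⟨hdMN, hiMN⟩ := hR 1 ((M * N : ℕ) : ℚ) c one_pos
  obtain ⟨hdM, hiM⟩ := hR 1 (M:ℚ) c one_pos
  obtain ⟨hdN, hiN⟩ := hR 1 (N:ℚ) c one_pos
  obtain ⟨hd₂, hi₂⟩ := hR (M:ℚ) ((M * N : ℕ) : ℚ) c hM0
  -- splitting `[(1,MN)] ≡ [(1,M)] + [(M,MN)]`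
  have h1 : of (R 1 ((M * N : ℕ) : ℚ) c) - of (R 1 (M:ℚ) c) - of (R (M:ℚ) ((M * N : ℕ) : ℚ) c) ∈
      relations :=
    split_mem_relations (R 1 ((M * N : ℕ) : ℚ) c) (R 1 (M:ℚ) c) (R (M:ℚ) ((M * N : ℕ) : ℚ) c)
      hdMN hdM hd₂ (by push_cast; exact_mod_cast hM)
      (by push_cast; exact_mod_cast Nat.le_mul_of_pos_right M hN)
      (fun x _ => by rw [hiM, hiMN]) (fun x _ => by rw [hi₂, hiMN])
  -- scaling `[(1,N)] ≡ [(M, MN)]`, dilation factor `M`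
  have hs1 : (M:ℚ) * 1 = M := mul_one _
  have hs2 : (M:ℚ) * N = ((M * N : ℕ) : ℚ) := by push_cast; ring
  have h2 : of (R 1 (N:ℚ) c) - of (R (M:ℚ) ((M * N : ℕ) : ℚ) c) ∈ relations :=
    dlog_scale_mem_relations (s := (M:ℚ)) (R 1 (N:ℚ) c) (R (M:ℚ) ((M * N : ℕ) : ℚ) c) hdN
      (by rw [hs1, hs2]; exact hd₂) (fun x _ => by rw [hiN]) (fun x _ => by rw [hi₂]) one_pos hM0
  rw [← map_add, QuotientAddGroup.mk'_apply, QuotientAddGroup.mk'_apply,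
    QuotientAddGroup.eq_iff_sub_mem]
  have : of (R 1 ((M * N : ℕ) : ℚ) c) - (of (R 1 (M:ℚ) c) + of (R 1 (N:ℚ) c)) =
      (of (R 1 ((M * N : ℕ) : ℚ) c) - of (R 1 (M:ℚ) c) - of (R (M:ℚ) ((M * N : ℕ) : ℚ) c)) -
        (of (R 1 (N:ℚ) c) - of (R (M:ℚ) ((M * N : ℕ) : ℚ) c)) := by abel
  rw [this]
  exact relations.sub_mem h1 h2

/-- **Carriers factor through unique factorisation**: for `0 < N`,
`Λ(N, c) = Σ_{p | N} v_p(N) • Λ(p, c)` in `FormalRep ⧸ relations` (with `Λ(1, c) = 0`, an empty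
slab). [cite: KontsevichZagier2001, §1.2 rules (1), (2)] -/
theorem carrier_eq_sum_factorization
    (hR : ∀ a b c, 0 < a → (R a b c).domain = {x | x 0 ∈ Set.Ioo (a:ℝ) b} ∧
      (R a b c).integrand = fun x => (c:ℝ) / x 0)
    (c : ℚ) (N : ℕ) (hN : 0 < N) :
    QuotientAddGroup.mk' relations (of (R 1 N c)) =
      N.factorization.sum fun p k => k • QuotientAddGroup.mk' relations (of (R 1 p c)) := by
  induction N using induction_on_primes with
  | zero => exact absurd hN (lt_irrefl 0)
  | one =>
    rw [Nat.factorization_one, Finsupp.sum_zero_index, QuotientAddGroup.mk'_apply,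
      QuotientAddGroup.eq_zero_iff]
    exact slab_empty_mem_relations (R 1 ((1:ℕ):ℚ) c) (hR 1 ((1:ℕ):ℚ) c one_pos).1 (by push_cast; rfl)
  | prime_mul p a hp ih =>
    have ha : 0 < a := Nat.pos_of_ne_zero fun h => by simp [h] at hN
    rw [carrier_mul hR p a hp.one_le ha c, ih ha, Nat.factorization_mul hp.ne_zero ha.ne',
      Finsupp.sum_add_index'
        (h := fun (q : ℕ) (k : ℕ) => k • QuotientAddGroup.mk' relations (of (R 1 (q:ℚ) c)))
        (fun _ => zero_nsmul _) (fun _ _ _ => add_nsmul _ _ _),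
      hp.factorization,
      Finsupp.sum_single_index
        (h := fun (q : ℕ) (k : ℕ) => k • QuotientAddGroup.mk' relations (of (R 1 (q:ℚ) c)))
        (zero_nsmul _), one_nsmul]

/-- A positive rational times the product of two denominators containing its own is a positive
natural number: `den(a)·e·a = num(a)·e ∈ ℕ` for `0 < a`. [folklore] -/
theorem exists_natCast_eq_den_mul (a : ℚ) (ha : 0 < a) (e : ℕ) :
    ∃ A : ℕ, (A:ℚ) = ((a.den * e : ℕ) : ℚ) * a := by
  refine ⟨a.num.toNat * e, ?_⟩
  have h1 : ((a.num.toNat : ℕ) : ℚ) = (a.num : ℚ) := by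
    rw [← Int.cast_natCast, Int.toNat_of_nonneg (Rat.num_pos.mpr ha).le]
  push_cast
  rw [h1, ← Rat.mul_den_eq_num a]
  ring

/-- **Step 2, difference of two integer carriers.** For rationals `0 < a < b` and `c`, clearing
denominators by the dilation `y ↦ D y` with `D = den(a)·den(b)` (scaling, rule 2) and splitting
`[(1,B), c/y]` at the point `A` (rule 1a) gives `[(a,b), c/y] = Λ(B, c) − Λ(A, c)` in
`FormalRep ⧸ relations`, with the natural numbers `1 ≤ A = D a < B = D b`.
[cite: KontsevichZagier2001, §1.2 rules (1), (2)] -/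
theorem dlog_eq_carrier_sub
    (hR : ∀ a b c, 0 < a → (R a b c).domain = {x | x 0 ∈ Set.Ioo (a:ℝ) b} ∧
      (R a b c).integrand = fun x => (c:ℝ) / x 0)
    {a b : ℚ} (ha : 0 < a) (hab : a < b) (c : ℚ) :
    ∃ A B : ℕ, 1 ≤ A ∧ A < B ∧
      QuotientAddGroup.mk' relations (of (R a b c)) =
        QuotientAddGroup.mk' relations (of (R 1 B c)) -
          QuotientAddGroup.mk' relations (of (R 1 A c)) := by
  have hb : 0 < b := ha.trans hab
  -- the integers `A = D a`, `B = D b`, `D = den(a)·den(b)`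
  obtain ⟨A, hA⟩ := exists_natCast_eq_den_mul a ha b.den
  obtain ⟨B, hB⟩ := exists_natCast_eq_den_mul b hb a.den
  have hD : ((b.den * a.den : ℕ) : ℚ) = ((a.den * b.den : ℕ) : ℚ) := by rw [mul_comm]
  rw [hD] at hB
  set D : ℕ := a.den * b.den with hD_def
  have hD0 : (0:ℚ) < D := by
    have : 0 < D := Nat.mul_pos a.den_pos b.den_pos
    exact_mod_cast this
  have hA0 : (0:ℚ) < A := by rw [hA]; exact mul_pos hD0 ha
  have hA1 : 1 ≤ A := Nat.one_le_iff_ne_zero.mpr fun h => by simp [h] at hA0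
  have hABq : (A:ℚ) < B := by rw [hA, hB]; exact mul_lt_mul_of_pos_left hab hD0
  have hAB : A < B := by exact_mod_cast hABq
  refine ⟨A, B, hA1, hAB, ?_⟩
  obtain ⟨hdab, hiab⟩ := hR a b c ha
  obtain ⟨hdAB, hiAB⟩ := hR A B c hA0
  obtain ⟨hd1B, hi1B⟩ := hR 1 B c one_pos
  obtain ⟨hd1A, hi1A⟩ := hR 1 A c one_pos
  -- the scaling move `[(a,b), c/y] ≡ [(A,B), c/y]`, dilation factor `D`
  have h1 : of (R a b c) - of (R A B c) ∈ relations :=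
    dlog_scale_mem_relations (s := (D:ℚ)) (R a b c) (R A B c) hdab (by rw [← hA, ← hB]; exact hdAB)
      (fun x _ => by rw [hiab]) (fun x _ => by rw [hiAB]) ha hD0
  -- the splitting move `[(1,B), c/y] ≡ [(1,A), c/y] + [(A,B), c/y]`
  have h2 : of (R 1 B c) - of (R 1 A c) - of (R A B c) ∈ relations :=
    split_mem_relations (R 1 B c) (R 1 A c) (R A B c) hd1B hd1A hdAB (by exact_mod_cast hA1)
      (by exact_mod_cast hAB.le) (fun x _ => by rw [hi1A, hi1B]) (fun x _ => by rw [hiAB, hi1B])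
  -- bookkeeping in the quotient
  rw [← map_sub, QuotientAddGroup.mk'_apply, QuotientAddGroup.mk'_apply,
    QuotientAddGroup.eq_iff_sub_mem]
  have : of (R a b c) - (of (R 1 B c) - of (R 1 A c)) =
      (of (R a b c) - of (R A B c)) - (of (R 1 B c) - of (R 1 A c) - of (R A B c)) := by abel
  rw [this]
  exact relations.sub_mem h1 h2

/-- **Step 1, the affine move.** `T = [(0,1), c/(x − ρ)]` with `ρ ∉ [0,1]` rational is congruent
to a dlog representation `[(a, b), c'/y]` with `0 < a < b` rational (`y = x − ρ`, `c' = c` if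
`ρ < 0`; `y = ρ − x`, `c' = −c` if `ρ > 1`). [cite: KontsevichZagier2001, §1.2 rule (2)] -/
theorem exists_dlog_of_pole
    (hR : ∀ a b c, 0 < a → (R a b c).domain = {x | x 0 ∈ Set.Ioo (a:ℝ) b} ∧
      (R a b c).integrand = fun x => (c:ℝ) / x 0)
    {c ρ : ℚ} (hρ : (ρ:ℝ) ∉ Set.Icc (0:ℝ) 1) (T : IntegralRep 1)
    (hTd : T.domain = {x | x 0 ∈ Set.Ioo (0:ℝ) 1})
    (hTi : EqOn T.integrand (fun x => (c:ℝ) / (x 0 - ρ)) T.domain) :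
    ∃ a b c' : ℚ, 0 < a ∧ a < b ∧
      QuotientAddGroup.mk' relations (of T) = QuotientAddGroup.mk' relations (of (R a b c')) := by
  simp only [Set.mem_Icc, not_and_or, not_le] at hρ
  rcases hρ with hρ | hρ
  · -- `ρ < 0`: translation `y = x − ρ`, onto `(−ρ, 1 − ρ)`
    have hρ' : ρ < 0 := by exact_mod_cast hρ
    have ha : (0:ℚ) < -ρ := neg_pos.mpr hρ'
    obtain ⟨hd, hi⟩ := hR (-ρ) (1 - ρ) c ha
    refine ⟨-ρ, 1 - ρ, c, ha, by linarith, ?_⟩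
    rw [QuotientAddGroup.mk'_apply, QuotientAddGroup.mk'_apply, QuotientAddGroup.eq_iff_sub_mem]
    refine affine_sub_mem_relations (s := 1) (t := -ρ) one_ne_zero T (R (-ρ) (1 - ρ) c)
      (fun y => (c:ℝ) / y) ?_ (fun x _ => by rw [hi]) (fun x hx => ?_)
    · rw [hTd, image_affine_slab_of_pos (by norm_num : (0:ℝ) < ((1:ℚ):ℝ)), hd]
      ext x
      push_cast
      ring_nf
    · rw [hTi hx]
      push_cast
      simp only [one_mul, abs_one, mul_one, sub_eq_add_neg]
  · -- `1 < ρ`: reflection `y = ρ − x`, onto `(ρ − 1, ρ)`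
    have hρ' : 1 < ρ := by exact_mod_cast hρ
    have ha : (0:ℚ) < ρ - 1 := by linarith
    obtain ⟨hd, hi⟩ := hR (ρ - 1) ρ (-c) ha
    refine ⟨ρ - 1, ρ, -c, ha, by linarith, ?_⟩
    rw [QuotientAddGroup.mk'_apply, QuotientAddGroup.mk'_apply, QuotientAddGroup.eq_iff_sub_mem]
    refine affine_sub_mem_relations (s := -1) (t := ρ) (by norm_num) T (R (ρ - 1) ρ (-c))
      (fun y => ((-c : ℚ):ℝ) / y) ?_ (fun x _ => by rw [hi]) (fun x hx => ?_)
    · rw [hTd, image_affine_slab_of_neg (by norm_num : ((-1:ℚ):ℝ) < 0), hd]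
      ext x
      push_cast
      ring_nf
    · have hx1 : x 0 < 1 := by rw [hTd] at hx; exact hx.2
      have hne : x 0 - ρ ≠ 0 := by
        have : (1:ℝ) < ρ := by exact_mod_cast hρ'
        linarith
      rw [hTi hx]
      push_cast
      rw [abs_neg, abs_one, mul_one]
      rw [div_eq_div_iff hne (by intro h; apply hne; linarith)]
      ring

/-- **Stub `nf_pole_one`** (registered sub-goal of crux stmt-KontsevichZagierPeriods-3869, line
`SketchIdeator1`, split-denominator layer). For rationals `c` and `ρ ∉ [0,1]`, the simple-pole
representation `T = [(0,1), c/(x − ρ)]` is, in `FormalRep ⧸ relations`, in the normal form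
`[pt, r] + Σ_{p ∈ S} [(1,p), C_p/y]` with `r ∈ ℚ` (here `r = 0`), `S` a finite set of primes and
`C : ℕ → ℚ` supported on `S`: affine move onto a dlog representation, difference of two integer
carriers, unique factorisation of the carriers, additivity in the coefficient.
[cite: KontsevichZagier2001, §1.2 rules (1), (2)] -/
theorem nf_pole_one {R : ℚ → ℚ → ℚ → IntegralRep 1} {Z : ℚ → IntegralRep 0}
    (hR : ∀ a b c, 0 < a → (R a b c).domain = {x | x 0 ∈ Set.Ioo (a:ℝ) b} ∧
      (R a b c).integrand = fun x => (c:ℝ) / x 0)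
    (hZ : ∀ r, (Z r).domain = univ ∧ (Z r).integrand = fun _ => (r:ℝ))
    {c ρ : ℚ} (hρ : (ρ:ℝ) ∉ Set.Icc (0:ℝ) 1) (T : IntegralRep 1)
    (hTd : T.domain = {x | x 0 ∈ Set.Ioo (0:ℝ) 1})
    (hTi : EqOn T.integrand (fun x => (c:ℝ) / (x 0 - ρ)) T.domain) :
    ∃ (r : ℚ) (S : Finset ℕ) (C : ℕ → ℚ), (∀ p ∈ S, p.Prime) ∧ (∀ p, p ∉ S → C p = 0) ∧
      QuotientAddGroup.mk' relations (of T) =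
        QuotientAddGroup.mk' relations (of (Z r)) +
          ∑ p ∈ S, QuotientAddGroup.mk' relations (of (R 1 p (C p))) := by
  -- Step 1: affine move onto a dlog representation `[(a,b), c'/y]`
  obtain ⟨a, b, c', ha, hab, hT⟩ := exists_dlog_of_pole hR hρ T hTd hTi
  -- Step 2: difference of two integer carriers
  obtain ⟨A, B, hA, hAB, hL⟩ := dlog_eq_carrier_sub hR ha hab c'
  have hB : 0 < B := lt_of_lt_of_le (lt_of_lt_of_le one_pos hA) hAB.le
  -- Step 3: unique factorisation of the carriers, on the common prime support `S`
  set S : Finset ℕ := A.primeFactors ∪ B.primeFactors with hS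
  have hsumA : QuotientAddGroup.mk' relations (of (R 1 A c')) =
      ∑ p ∈ S, A.factorization p • QuotientAddGroup.mk' relations (of (R 1 p c')) := by
    rw [carrier_eq_sum_factorization hR c' A hA]
    exact Finsupp.sum_of_support_subset _ (by rw [Nat.support_factorization]; exact
      Finset.subset_union_left) _ fun _ _ => zero_nsmul _
  have hsumB : QuotientAddGroup.mk' relations (of (R 1 B c')) =
      ∑ p ∈ S, B.factorization p • QuotientAddGroup.mk' relations (of (R 1 p c')) := by
    rw [carrier_eq_sum_factorization hR c' B hB]
    exact Finsupp.sum_of_support_subset _ (by rw [Nat.support_factorization]; exact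
      Finset.subset_union_right) _ fun _ _ => zero_nsmul _
  -- Step 5: the rational part is `[pt, 0] = 0`
  have hZ0 : QuotientAddGroup.mk' relations (of (Z 0)) = 0 := by
    rw [QuotientAddGroup.mk'_apply, QuotientAddGroup.eq_zero_iff]
    exact pt_zero_mem_relations (Z 0) (by rw [(hZ 0).2, Rat.cast_zero])
  -- Step 4: assemble, absorbing the multiplicities into the coefficients
  refine ⟨0, S, fun p => ((B.factorization p : ℚ) - (A.factorization p : ℚ)) * c', ?_, ?_, ?_⟩
  · rintro p hp
    rcases Finset.mem_union.mp hp with hp | hp <;> exact Nat.prime_of_mem_primeFactors hp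
  · intro p hp
    rw [hS, Finset.mem_union, not_or] at hp
    have h1 : A.factorization p = 0 := Finsupp.notMem_support_iff.mp hp.1
    have h2 : B.factorization p = 0 := Finsupp.notMem_support_iff.mp hp.2
    simp [h1, h2]
  · rw [hT, hL, hsumA, hsumB, hZ0, zero_add, ← Finset.sum_sub_distrib]
    refine Finset.sum_congr rfl fun p _ => ?_
    dsimp only
    rw [sub_mul, carrier_sub hR, carrier_natCast_mul hR, carrier_natCast_mul hR]

end LandedAssembly

end Summit.KontsevichZagierPeriods.HurwitzMicroSectors.NormalFormPrinciple.PiBox.Dlog
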